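import Literature.Probability.RandomPlanarGeometry.RestrictionHullsProofs
import Literature.Probability.RandomPlanarGeometry.RestrictionHullsRiemannProofs
import Literature.Probability.RandomPlanarGeometry.RestrictionConfigEvents
import HarnessLib

/-!
# One-sided restriction ([LSW] §8.1): the space `Ω₊`, the measures `P⁺_α`, their uniqueness, and Thm. 8.4 as used by Cor. 8.6

Level 3 of the decomposition of the named fact
`Literature.Probability.RandomPlanarGeometry.IsRestrictionMeasure.eq_five_eighths_of_outer_simple` (file `RestrictionMeasures`; plan in
`RestrictionMeasuresFiveEighths`): the vocabulary and the deep input of the proof of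
[LSW] Cor. 8.6 ("For all `α < 5/8`, the two-sided restriction probability measure `P_α` does
not exist"), after

* G. F. Lawler, O. Schramm, W. Werner, *Conformal restriction: the chordal case*, J. Amer. Math.
  Soc. **16** (2003) 917–955, arXiv:math/0209343 (**[LSW]**, arXiv page numbers), §8.1 p. 31:
  "Let `Ω₊` denote the set of all closed connected sets `K ⊂ ℍ̄` such that `K ∩ ℝ = (−∞, 0]`
  and `ℍ ∖ K` is connected. We endow `Ω₊` with the σ-field generated by the family of events
  `{K ∩ A = ∅}`, where `A ∈ 𝒬₊`. […] there exists a constant `α ≥ 0` such that for all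
  `A ∈ 𝒬₊`, `P[K ∩ A = ∅] = Φ'_A(0)^α`. Conversely, for all `α ≥ 0`, there exists at most one
  such probability measure `P`. If it exists, we call it the right-sided restriction measure
  with exponent `α` and denote it by `P⁺_α`."

Contents:

* `Literature.Probability.RandomPlanarGeometry.rightConfigs` / `Literature.Probability.RandomPlanarGeometry.RightConfig` — `Ω₊` verbatim, with the avoidance events
  `RightConfig.avoid A = {K ∩ A = ∅}` and the σ-field they generate for `A ∈ 𝒬₊`
  (`RightConfig.instMeasurableSpace`); non-vacuity: `(−∞, 0] ∈ Ω₊` (`RightConfig.negAxis`,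
  "the uninteresting case `α = 0`, where `K = (−∞, 0]` a.s.");
* `Literature.IsRightRestrictionMeasure α Q` — `Q = P⁺_α`: a probability measure on `Ω₊` with
  `Q[K ∩ A = ∅] = Φ'_A(0)^α` for all `A ∈ 𝒬₊` (all restriction data `(Φ_A, Φ'_A(0))`, as in the
  tree's two-sided `IsRestrictionMeasure`);
* PROVED — **uniqueness of `P⁺_α`** (`IsRightRestrictionMeasure.unique`, "there exists at most
  one such probability measure"): the events `{K ∩ A = ∅}`, `A ∈ 𝒬₊`, form a π-system
  (`RightConfig.isPiSystem_avoid`: `{K ∩ A = ∅} ∩ {K ∩ A' = ∅} = {K ∩ hpFill (A ∪ A') = ∅}`,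
  where the half-plane fill of `A ∪ A'` ([LSW] §2 p. 8 "Fillings", file `HalfPlaneFill`) is
  again a `+`-hull — a closed bounded set off the nonpositive axis has its fill off that axis,
  `ofReal_notMem_hpFill`, and a configuration of `Ω₊` avoiding it avoids its fill,
  `RightConfig.disjoint_hpFill` — then Dynkin's π-λ theorem);
* PROVED — the event **"`z` lies to the right of `K`"**, `{K ∈ Ω₊ : z ∉ K}` (`z ∈ ℍ`), is
  measurable (`RightConfig.measurableSet_notMem`: it is the union of the countably many events
  "`K` avoids the `+`-hull filled from the dyadic squares along a path from `z` to `1` in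
  `ℍ ∖ K`", cf. `RestrictionConfigEvents`);
* NAMED FACT — `Literature.Probability.RandomPlanarGeometry.exists_isRightRestrictionMeasure_lt_five_eighths`: the input of the proof
  of Cor. 8.6 from SLE(8/3, ρ) — [LSW] **Thm. 8.4** (p. 37) with Lemma 8.3 (p. 36), §8.1 and
  the first half of the proof of Cor. 8.6 (p. 38): for `0 < α < 5/8` the measure `P⁺_α`
  exists (it is the law of `F^{ℝ₊}_ℍ(cl K_∞)` for SLE(8/3, ρ(α)), `ρ(α) ∈ (−2, 0)`) and gives
  probability `> 1/2` to `{i ∉ K}` ("the probability that `i` ends up eventually to the right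
  of the right hand boundary of SLE(8/3, ρ) … is strictly larger than the corresponding
  quantity for SLE(8/3, 0), which is `1/2` by symmetry"). This is the deep leaf (Bessel-type
  driving processes, Itô's formula for `h_t'(W_t)^{5/8} …`, §8.3–8.4, are not in the tree).

The remaining, elementary half of the proof of Cor. 8.6 — `F^{ℝ₊}_ℍ` pushes `P_α` to `P⁺_α`,
and by the `σ`-symmetry of `P_α` the `P_α`-probability that `i` is to the right of `K` is at
most `1/2` — is assembled from `RestrictionSides`, `RestrictionReflection` and this file in
`RestrictionLeftFillLaw`.

Mathlib: `MeasurableSpace.generateFrom`, `IsPiSystem`, `MeasureTheory.ext_of_generate_finite`,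
`Convex.thickening`, `IsCompact.exists_thickening_subset_open`,
`IsPreconnected.subset_of_closure_inter_subset`.
-/

noncomputable section

open Set Filter Topology MeasureTheory Metric Bornology Complex
open UpperHalfPlane (upperHalfPlaneSet isOpen_upperHalfPlaneSet)
open scoped NNReal ENNReal

namespace Literature.Probability.RandomPlanarGeometry

/-! ### The nonpositive real axis and fills off it -/

/-- The nonpositive real axis `(−∞, 0] ⊆ ℂ`. [folklore] -/
def nonposAxis : Set ℂ := ((↑) : ℝ → ℂ) '' Iic 0

/-- Membership in the nonpositive axis. [folklore] -/
theorem mem_nonposAxis_iff {z : ℂ} : z ∈ nonposAxis ↔ z.im = 0 ∧ z.re ≤ 0 := by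
  constructor
  · rintro ⟨x, hx, rfl⟩
    exact ⟨by simp, by simpa using hx⟩
  · rintro ⟨h1, h2⟩
    exact ⟨z.re, h2, Complex.ext (by simp) (by simp [h1])⟩

/-- The nonpositive axis is closed. [folklore] -/
theorem isClosed_nonposAxis : IsClosed nonposAxis := by
  have : nonposAxis = {z : ℂ | z.im = 0} ∩ {z : ℂ | z.re ≤ 0} := by
    ext z
    simp [mem_nonposAxis_iff]
  rw [this]
  exact (isClosed_eq Complex.continuous_im continuous_const).inter
    (isClosed_le Complex.continuous_re continuous_const)

/-- The nonpositive axis is convex. [folklore] -/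
theorem convex_nonposAxis : Convex ℝ nonposAxis := by
  have : nonposAxis = {z : ℂ | z.im = 0} ∩ {z : ℂ | z.re ≤ 0} := by
    ext z
    simp [mem_nonposAxis_iff]
  rw [this]
  exact (convex_hyperplane Complex.imLm.isLinear 0).inter (convex_halfSpace_re_le 0)

/-- The nonpositive axis is connected. [folklore] -/
theorem isConnected_nonposAxis : IsConnected nonposAxis :=
  ⟨⟨0, ⟨0, mem_Iic.2 le_rfl, by simp⟩⟩, convex_nonposAxis.isPreconnected⟩

/-- The nonpositive axis is unbounded. [folklore] -/
theorem not_isBounded_nonposAxis : ¬ IsBounded nonposAxis := by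
  intro hb
  obtain ⟨C, hC⟩ := hb.subset_closedBall 0
  have hmem : (((-(|C| + 1)) : ℝ) : ℂ) ∈ nonposAxis := ⟨-(|C| + 1), by
    have := abs_nonneg C
    simp only [mem_Iic]; linarith, rfl⟩
  have h := hC hmem
  rw [mem_closedBall, dist_zero_right, Complex.norm_real, Real.norm_eq_abs, abs_neg,
    abs_of_pos (by positivity)] at h
  linarith [le_abs_self C]

section Fill

variable {S : Set ℂ}

/-- **A closed bounded set off the nonpositive axis leaves a channel along it**: there is
`δ > 0` such that the convex unbounded set `{z ∈ ℍ : dist(z, (−∞, 0]) < δ}` misses `S`, hence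
lies in the unbounded component of `ℍ ∖ S`. [folklore] -/
theorem exists_channel (hS : IsClosed S) (hSb : IsBounded S) (hdisj : Disjoint S nonposAxis) :
    ∃ δ > 0, thickening δ nonposAxis ∩ upperHalfPlaneSet ⊆
      Loewner.unboundedComponent (upperHalfPlaneSet \ S) ∧
      Disjoint (thickening δ nonposAxis) S := by
  have hSc : IsCompact S := Metric.isCompact_of_isClosed_isBounded hS hSb
  obtain ⟨δ, hδ, hδS⟩ := hSc.exists_thickening_subset_open isClosed_nonposAxis.isOpen_compl
    (Set.disjoint_left.1 hdisj)
  have hdisj' : Disjoint (thickening δ nonposAxis) S := by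
    rw [Set.disjoint_left]
    intro z hz hzS
    rw [Metric.mem_thickening_iff] at hz
    obtain ⟨x, hx, hzx⟩ := hz
    have : x ∈ thickening δ S := Metric.mem_thickening_iff.2 ⟨z, hzS, by rwa [dist_comm]⟩
    exact hδS this hx
  refine ⟨δ, hδ, ?_, hdisj'⟩
  refine subset_unboundedComponent_of_isPreconnected ?_ ?_ ?_
  · exact ((convex_nonposAxis.thickening δ).inter (convex_halfSpace_im_gt 0)).isPreconnected
  · rintro z ⟨hz, hzH⟩
    exact ⟨hzH, fun hzS ↦ Set.disjoint_left.1 hdisj' hz hzS⟩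
  · intro hb
    obtain ⟨C, hC⟩ := hb.subset_closedBall 0
    have hmem : (((-(|C| + 1)) : ℝ) : ℂ) + ((δ / 2 : ℝ) : ℂ) * Complex.I ∈
        thickening δ nonposAxis ∩ upperHalfPlaneSet := by
      refine ⟨Metric.mem_thickening_iff.2 ⟨(((-(|C| + 1)) : ℝ) : ℂ), ⟨-(|C| + 1), by
        have := abs_nonneg C
        simp only [mem_Iic]; linarith, rfl⟩, ?_⟩, ?_⟩
      · rw [dist_eq_norm, add_sub_cancel_left, norm_mul, Complex.norm_real, Complex.norm_I, mul_one,
          Real.norm_eq_abs, abs_of_pos (by positivity)]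
        linarith
      · show 0 < ((((-(|C| + 1)) : ℝ) : ℂ) + ((δ / 2 : ℝ) : ℂ) * Complex.I).im
        simp only [Complex.add_im, Complex.ofReal_im, Complex.mul_im, Complex.ofReal_re,
          Complex.I_im, mul_one, Complex.I_re, mul_zero, add_zero, zero_add]
        positivity
    have h := hC hmem
    rw [mem_closedBall, dist_zero_right] at h
    have hre := (Complex.abs_re_le_norm _).trans h
    simp only [Complex.add_re, Complex.ofReal_re, Complex.mul_re, Complex.I_re, mul_zero,
      Complex.ofReal_im, Complex.I_im, mul_one, sub_self, add_zero] at hre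
    rw [abs_le] at hre
    linarith [le_abs_self C, abs_nonneg C, hre.1]

/-- **The fill of a closed bounded set off the nonpositive axis is off that axis**: a point
`x ≤ 0` in `hpFill S = cl(ℍ ∖ V)` would have points of `ℍ ∖ V` in the channel, which lies in
the unbounded component `V`. [folklore] -/
theorem ofReal_notMem_hpFill (hS : IsClosed S) (hSb : IsBounded S) (hdisj : Disjoint S nonposAxis)
    {x : ℝ} (hx : x ≤ 0) : (x : ℂ) ∉ hpFill S := by
  obtain ⟨δ, hδ, hV, -⟩ := exists_channel hS hSb hdisj
  intro hxF
  change (x : ℂ) ∈ closure (upperHalfPlaneSet \ Loewner.unboundedComponent (upperHalfPlaneSet \ S)) at hxF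
  rw [_root_.mem_closure_iff] at hxF
  obtain ⟨w, hwB, hwH, hwV⟩ := hxF (ball (x : ℂ) δ) isOpen_ball (mem_ball_self hδ)
  refine hwV (hV ⟨Metric.mem_thickening_iff.2 ⟨(x : ℂ), ⟨x, hx, rfl⟩, ?_⟩, hwH⟩)
  rwa [mem_ball] at hwB

/-- **The fill of a closed bounded set off the nonpositive axis, attached to the lower
half-plane, is a `+`-hull.** [cite: LawlerSchrammWerner2003Restriction, §2 p. 8 (Fillings; 𝒬₊)] -/
theorem isPlusHull_hpFill (hS : IsClosed S) (hSb : IsBounded S) (hdisj : Disjoint S nonposAxis)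
    (hconn : IsConnected (S ∪ {z : ℂ | z.im ≤ 0})) : IsPlusHull (hpFill S) := by
  refine ⟨⟨isBoundedHull_hpFill isSimplyConnected_of_isConnected_compl_holds hS hSb hconn, ?_⟩, ?_⟩
  · exact_mod_cast ofReal_notMem_hpFill hS hSb hdisj le_rfl
  · intro x hx
    by_contra h
    exact ofReal_notMem_hpFill hS hSb hdisj (not_lt.1 h) hx

end Fill

/-! ### The space `Ω₊` ([LSW] §8.1) -/

/-- **[LSW] §8.1** (p. 31): "Let `Ω₊` denote the set of all closed connected sets `K ⊂ ℍ̄`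
such that `K ∩ ℝ = (−∞, 0]` and `ℍ ∖ K` is connected." [cite: LawlerSchrammWerner2003Restriction, §8.1 p. 31 (Ω₊)] -/
def rightConfigs : Set (Set ℂ) :=
  {K | IsClosed K ∧ IsConnected K ∧ K ⊆ {z : ℂ | 0 ≤ z.im} ∧
    K ∩ range ((↑) : ℝ → ℂ) = nonposAxis ∧ IsConnected (upperHalfPlaneSet \ K)}

/-- The type of one-sided configurations `K ∈ Ω₊` ([LSW] §8.1), on which the right-sided
restriction measures `P⁺_α` live. [cite: LawlerSchrammWerner2003Restriction, §8.1 p. 31 (Ω₊)] -/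
def RightConfig : Type := {K : Set ℂ // K ∈ rightConfigs}

namespace RightConfig

/-- The underlying set of a one-sided configuration. [folklore] -/
instance instCoe : CoeOut RightConfig (Set ℂ) := ⟨Subtype.val⟩

variable (K : RightConfig)

/-- A one-sided configuration is closed. [folklore] -/
theorem isClosed : IsClosed (K : Set ℂ) := K.2.1

/-- A one-sided configuration is connected. [folklore] -/
theorem isConnected : IsConnected (K : Set ℂ) := K.2.2.1

/-- A one-sided configuration lies in the closed upper half-plane. [folklore] -/
theorem im_nonneg {z : ℂ} (hz : z ∈ (K : Set ℂ)) : 0 ≤ z.im := K.2.2.2.1 hz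

/-- The real points of a one-sided configuration form the nonpositive axis. [folklore] -/
theorem inter_range_ofReal : (K : Set ℂ) ∩ range ((↑) : ℝ → ℂ) = nonposAxis := K.2.2.2.2.1

/-- The complement of a one-sided configuration in `ℍ` is connected. [folklore] -/
theorem isConnected_diff : IsConnected (upperHalfPlaneSet \ (K : Set ℂ)) := K.2.2.2.2.2

/-- `(−∞, 0] ⊆ K`. [folklore] -/
theorem nonposAxis_subset : nonposAxis ⊆ (K : Set ℂ) := by
  rw [← K.inter_range_ofReal]
  exact inter_subset_left

/-- A real point of `K` is nonpositive. [folklore] -/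
theorem ofReal_mem_iff {x : ℝ} : (x : ℂ) ∈ (K : Set ℂ) ↔ x ≤ 0 := by
  constructor
  · intro hx
    have : (x : ℂ) ∈ (K : Set ℂ) ∩ range ((↑) : ℝ → ℂ) := ⟨hx, x, rfl⟩
    rw [K.inter_range_ofReal, mem_nonposAxis_iff] at this
    simpa using this.2
  · exact fun hx ↦ K.nonposAxis_subset ⟨x, hx, rfl⟩

/-- A one-sided configuration is unbounded. [folklore] -/
theorem not_isBounded : ¬ IsBounded (K : Set ℂ) := fun h ↦
  not_isBounded_nonposAxis (h.subset K.nonposAxis_subset)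

/-- A point of `K` off `ℍ` is on the nonpositive axis. [folklore] -/
theorem mem_nonposAxis_of_mem {z : ℂ} (hz : z ∈ (K : Set ℂ)) (hzH : z ∉ upperHalfPlaneSet) :
    z ∈ nonposAxis := by
  have him : z.im = 0 := le_antisymm (not_lt.1 hzH) (K.im_nonneg hz)
  rw [← K.inter_range_ofReal]
  exact ⟨hz, z.re, Complex.ext (by simp) (by simp [him])⟩

/-- The event "`K` avoids `A`", `{K ∈ Ω₊ : K ∩ A = ∅}` ([LSW] §8.1 p. 31). [cite: LawlerSchrammWerner2003Restriction, §8.1 p. 31] -/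
def avoid (A : Set ℂ) : Set RightConfig := {K | Disjoint (K : Set ℂ) A}

/-- Membership in the avoidance event. [folklore] -/
@[simp] theorem mem_avoid {A : Set ℂ} {K : RightConfig} : K ∈ avoid A ↔ Disjoint (K : Set ℂ) A :=
  Iff.rfl

/-- Avoiding a union is avoiding both parts. [folklore] -/
theorem avoid_union (A A' : Set ℂ) : avoid (A ∪ A') = avoid A ∩ avoid A' := by
  ext K
  simp [disjoint_union_right]

/-- **The σ-field on `Ω₊`** ([LSW] §8.1 p. 31): "We endow `Ω₊` with the σ-field generated by the
family of events `{K ∩ A = ∅}`, where `A ∈ 𝒬₊`." [cite: LawlerSchrammWerner2003Restriction, §8.1 p. 31] -/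
instance instMeasurableSpace : MeasurableSpace RightConfig :=
  MeasurableSpace.generateFrom {S | ∃ A, IsPlusHull A ∧ S = avoid A}

/-- The generating events are measurable. [folklore] -/
theorem measurableSet_avoid {A : Set ℂ} (hA : IsPlusHull A) : MeasurableSet (avoid A) :=
  MeasurableSpace.measurableSet_generateFrom ⟨A, hA, rfl⟩

/-- **`(−∞, 0] ∈ Ω₊`** ("the uninteresting case `α = 0`, where `K = (−∞, 0]` a.s.", [LSW]
§8.1 p. 31): non-vacuity of `Ω₊`. [cite: LawlerSchrammWerner2003Restriction, §8.1 p. 31] -/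
def negAxis : RightConfig :=
  ⟨nonposAxis, isClosed_nonposAxis, isConnected_nonposAxis,
    fun z hz ↦ by
      show 0 ≤ z.im
      rw [(mem_nonposAxis_iff.1 hz).1],
    by
      ext z
      simp only [mem_inter_iff, and_iff_left_iff_imp]
      rintro ⟨x, -, rfl⟩
      exact ⟨x, rfl⟩,
    by
      have : upperHalfPlaneSet \ nonposAxis = upperHalfPlaneSet := by
        refine sdiff_eq_left.2 (Set.disjoint_left.2 fun z hzH hz ↦ ?_)
        rw [mem_nonposAxis_iff] at hz
        have : (0 : ℝ) < z.im := hzH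
        rw [hz.1] at this
        exact lt_irrefl _ this
      rw [this]
      exact (convex_halfSpace_im_gt 0).isConnected ⟨Complex.I, by simp⟩⟩

/-- `Ω₊` is nonempty. [folklore] -/
instance instNonempty : Nonempty RightConfig := ⟨negAxis⟩

/-! ### Configurations of `Ω₊` avoiding a test set avoid its fill -/

/-- **A configuration of `Ω₊` avoiding a closed bounded `S` (off the nonpositive axis) avoids
its fill**: if `z ∈ K ∩ ℍ` were in a bounded component `U` of `ℍ ∖ S`, the connected unbounded
`K ∌ S` would reach the frontier of `U` inside `ℍ̄ ∖ S`, i.e. at a real point `x ≤ 0` of `K`;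
but near `x` the channel along `(−∞, 0]` lies in the unbounded component. [folklore] -/
theorem disjoint_hpFill {S : Set ℂ} (hS : IsClosed S) (hSb : IsBounded S)
    (hdisj : Disjoint S nonposAxis) (hK : Disjoint (K : Set ℂ) S) :
    Disjoint (K : Set ℂ) (hpFill S) := by
  obtain ⟨δ, hδ, hV, hVS⟩ := exists_channel hS hSb hdisj
  set V := Loewner.unboundedComponent (upperHalfPlaneSet \ S) with hVdef
  rw [Set.disjoint_left]
  intro z hzK hzF
  by_cases hzH : z ∈ upperHalfPlaneSet
  swap
  · -- a real point of `K` in the fill would be `≤ 0`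
    obtain ⟨x, hx, rfl⟩ := K.mem_nonposAxis_of_mem hzK hzH
    exact ofReal_notMem_hpFill hS hSb hdisj hx hzF
  -- `z ∈ ℍ ∖ V`, in the bounded component `U` of `ℍ ∖ S`
  have hzV : z ∉ V := by
    have : z ∈ hpFill S ∩ upperHalfPlaneSet := ⟨hzF, hzH⟩
    rw [hpFill_inter hS hSb] at this
    exact this.2
  have hzS : z ∉ S := fun h ↦ Set.disjoint_left.1 hK hzK h
  set U : Set ℂ := connectedComponentIn (upperHalfPlaneSet \ S) z with hU
  have hUopen : IsOpen U := (isOpen_upperHalfPlaneSet.sdiff hS).connectedComponentIn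
  have hUb : IsBounded U := by
    by_contra hb
    exact hzV ⟨⟨hzH, hzS⟩, hb⟩
  have hUV : Disjoint U V := by
    rw [Set.disjoint_left]
    intro w hwU hwV
    apply hwV.2
    rw [← connectedComponentIn_eq hwU]
    exact hUb
  -- `K` is connected, meets `U`, is not inside `U`: it has a point of `cl U ∖ U`
  have hKU : ¬ (K : Set ℂ) ⊆ U := fun h ↦ K.not_isBounded (hUb.subset h)
  have hfront : ¬ closure U ∩ (K : Set ℂ) ⊆ U := fun h ↦
    hKU (K.isConnected.isPreconnected.subset_of_closure_inter_subset hUopen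
      ⟨z, hzK, mem_connectedComponentIn ⟨hzH, hzS⟩⟩ h)
  obtain ⟨f, ⟨hfU, hfK⟩, hfU'⟩ : ∃ f, f ∈ closure U ∩ (K : Set ℂ) ∧ f ∉ U := by
    by_contra h
    push Not at h
    exact hfront fun f hf ↦ h f hf
  -- such a point is not in `ℍ ∖ S` (components are relatively closed), nor in `S`: it is real
  have hfH : f ∉ upperHalfPlaneSet := fun hfH ↦ by
    have hfS : f ∉ S := fun h ↦ Set.disjoint_left.1 hK hfK h
    -- a small ball around `f` inside `ℍ ∖ S` meets `U`, so `f ∈ U`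
    obtain ⟨r, hr, hrsub⟩ := Metric.isOpen_iff.1 (isOpen_upperHalfPlaneSet.sdiff hS) f ⟨hfH, hfS⟩
    rw [_root_.mem_closure_iff] at hfU
    obtain ⟨w, hwB, hwU⟩ := hfU (ball f r) isOpen_ball (mem_ball_self hr)
    have hsub := (convex_ball f r).isPreconnected.subset_connectedComponentIn hwB hrsub
    rw [← connectedComponentIn_eq hwU] at hsub
    exact hfU' (hsub (mem_ball_self hr))
  obtain ⟨x, hx, rfl⟩ := K.mem_nonposAxis_of_mem hfK hfH
  -- points of `U` near `x` are in the channel, hence in `V`: contradiction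
  rw [_root_.mem_closure_iff] at hfU
  obtain ⟨w, hwB, hwU⟩ := hfU (ball (x : ℂ) δ) isOpen_ball (mem_ball_self hδ)
  have hwV : w ∈ V := hV ⟨Metric.mem_thickening_iff.2 ⟨(x : ℂ), ⟨x, hx, rfl⟩, by rwa [mem_ball] at hwB⟩,
    (connectedComponentIn_subset _ _ hwU).1⟩
  exact Set.disjoint_left.1 hUV hwU hwV

/-- **The avoidance event of the fill** on `Ω₊`: `{K ∩ hpFill S = ∅} = {K ∩ S = ∅}` for `S`
closed, bounded and off the nonpositive axis. [folklore] -/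
theorem avoid_hpFill {S : Set ℂ} (hS : IsClosed S) (hSb : IsBounded S) (hdisj : Disjoint S nonposAxis) :
    avoid (hpFill S) = avoid S := by
  ext K
  rw [mem_avoid, mem_avoid]
  refine ⟨fun h ↦ Set.disjoint_left.2 fun w hwK hwS ↦ ?_, K.disjoint_hpFill hS hSb hdisj⟩
  by_cases hwH : w ∈ upperHalfPlaneSet
  · exact Set.disjoint_left.1 h hwK (inter_subset_hpFill S ⟨hwS, hwH⟩)
  · exact Set.disjoint_left.1 hdisj hwS (K.mem_nonposAxis_of_mem hwK hwH)

/-! ### The generating events form a π-system; uniqueness of `P⁺_α` -/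

/-- A `+`-hull is off the nonpositive axis. [folklore] -/
theorem _root_.Literature.Probability.RandomPlanarGeometry.IsPlusHull.disjoint_nonposAxis {A : Set ℂ} (hA : IsPlusHull A) :
    Disjoint A nonposAxis := by
  rw [Set.disjoint_left]
  rintro _ hzA ⟨x, hx, rfl⟩
  exact absurd (hA.2 x hzA) (not_lt.2 hx)

/-- **The fill of the union of two `+`-hulls is a `+`-hull.** [cite: LawlerSchrammWerner2003Restriction, §2 p. 8 (Fillings; 𝒬₊)] -/
theorem _root_.Literature.Probability.RandomPlanarGeometry.IsPlusHull.hpFill_union {A A' : Set ℂ} (hA : IsPlusHull A) (hA' : IsPlusHull A') :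
    IsPlusHull (hpFill (A ∪ A')) := by
  have hc : IsClosed (A ∪ A') := hA.1.isBoundedHull.isClosed.union hA'.1.isBoundedHull.isClosed
  have hb : IsBounded (A ∪ A') := hA.1.isBoundedHull.1.union hA'.1.isBoundedHull.1
  have hconn : IsConnected ((A ∪ A') ∪ {z : ℂ | z.im ≤ 0}) := by
    have h1 := hA.1.isBoundedHull.isConnected_union_im_nonpos
    have h2 := hA'.1.isBoundedHull.isConnected_union_im_nonpos
    have : (A ∪ A') ∪ {z : ℂ | z.im ≤ 0} = (A ∪ {z : ℂ | z.im ≤ 0}) ∪ (A' ∪ {z : ℂ | z.im ≤ 0}) := by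
      ext z
      simp only [mem_union, mem_setOf_eq]
      tauto
    rw [this]
    exact IsConnected.union ⟨0, Or.inr (by simp), Or.inr (by simp)⟩ h1 h2
  exact isPlusHull_hpFill hc hb (disjoint_union_left.2 ⟨hA.disjoint_nonposAxis, hA'.disjoint_nonposAxis⟩) hconn

/-- **The events `{K ∩ A = ∅}`, `A ∈ 𝒬₊`, form a π-system** (the one-sided analogue of [LSW]
§3 p. 10, "this family of events is closed under finite intersection"):
`{K ∩ A = ∅} ∩ {K ∩ A' = ∅} = {K ∩ hpFill (A ∪ A') = ∅}`. [cite: LawlerSchrammWerner2003Restriction, §8.1 p. 31 with §3 p. 10] -/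
theorem isPiSystem_avoid : IsPiSystem {S : Set RightConfig | ∃ A, IsPlusHull A ∧ S = avoid A} := by
  rintro _ ⟨A, hA, rfl⟩ _ ⟨A', hA', rfl⟩ -
  refine ⟨hpFill (A ∪ A'), hA.hpFill_union hA', ?_⟩
  rw [← avoid_union, avoid_hpFill (hA.1.isBoundedHull.isClosed.union hA'.1.isBoundedHull.isClosed)
    (hA.1.isBoundedHull.1.union hA'.1.isBoundedHull.1)
    (disjoint_union_left.2 ⟨hA.disjoint_nonposAxis, hA'.disjoint_nonposAxis⟩)]

/-- **Two probability measures on `Ω₊` agreeing on the events `{K ∩ A = ∅}`, `A ∈ 𝒬₊`, are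
equal** (Dynkin's π-λ theorem; the one-sided Lemma 3.2). [cite: LawlerSchrammWerner2003Restriction, §8.1 p. 31 ("at most one such probability measure") with Lemma 3.2 (p. 10)] -/
theorem ext_of_avoid (Q Q' : Measure RightConfig) [IsProbabilityMeasure Q] [IsProbabilityMeasure Q']
    (h : ∀ A, IsPlusHull A → Q (avoid A) = Q' (avoid A)) : Q = Q' := by
  refine MeasureTheory.ext_of_generate_finite _ rfl isPiSystem_avoid ?_ (by rw [measure_univ, measure_univ])
  rintro _ ⟨A, hA, rfl⟩
  exact h A hA

end RightConfig

/-! ### Right-sided restriction measures `P⁺_α` ([LSW] §8.1) -/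

/-- **Right-sided restriction measure with exponent `α`** ([LSW] §8.1 p. 31): a probability
measure `Q` on `Ω₊` with `Q[K ∩ A = ∅] = Φ'_A(0)^α` for every `A ∈ 𝒬₊` — for every restriction
map `Φ` of `A` and every `d` with `HasRestrictionDeriv A Φ d` (`d = Φ'_A(0)`), as in the
two-sided `IsRestrictionMeasure`. "If it exists, we call it the right-sided restriction measure
with exponent `α` and denote it by `P⁺_α`." (By the proof of Prop. 3.3 this is equivalent to
the right-sided restriction property, `𝒜₊`-covariance and scale invariance.)
[cite: LawlerSchrammWerner2003Restriction, §8.1 p. 31 (P⁺_α)] -/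
def IsRightRestrictionMeasure (α : ℝ) (Q : Measure RightConfig) : Prop :=
  IsProbabilityMeasure Q ∧
    ∀ {A : Set ℂ}, IsPlusHull A →
      ∀ {Φ : ConformalEquiv (upperHalfPlaneSet \ A) upperHalfPlaneSet}, IsRestrictionMap A Φ →
        ∀ {d : ℝ}, HasRestrictionDeriv A Φ d → Q (RightConfig.avoid A) = ENNReal.ofReal (d ^ α)

/-- A right-sided restriction measure is a probability measure. [folklore] -/
theorem IsRightRestrictionMeasure.isProbabilityMeasure {α : ℝ} {Q : Measure RightConfig}
    (h : IsRightRestrictionMeasure α Q) : IsProbabilityMeasure Q :=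
  h.1

/-- **Uniqueness of `P⁺_α`** ([LSW] §8.1 p. 31: "for all `α ≥ 0`, there exists at most one such
probability measure `P`"), from the π-system property (`RightConfig.ext_of_avoid`) and the
existence of `Φ_A`, `Φ'_A(0)` for `*`-hulls (the tree's proofs
`IsStarHull.existsUnique_isRestrictionMap_holds`, `IsStarHull.exists_hasRestrictionDeriv_holds`).
[cite: LawlerSchrammWerner2003Restriction, §8.1 p. 31 (uniqueness of P⁺_α)] -/
theorem IsRightRestrictionMeasure.unique {α : ℝ} {Q Q' : Measure RightConfig}
    (h : IsRightRestrictionMeasure α Q) (h' : IsRightRestrictionMeasure α Q') : Q = Q' := by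
  haveI := h.1
  haveI := h'.1
  refine RightConfig.ext_of_avoid Q Q' fun A hA ↦ ?_
  obtain ⟨Φ, hΦA, -⟩ := IsStarHull.existsUnique_isRestrictionMap_holds hA.1
  obtain ⟨d, -, -, hdA⟩ := IsStarHull.exists_hasRestrictionDeriv_holds hA.1 hΦA
  rw [h.2 hA hΦA hdA, h'.2 hA hΦA hdA]

/-! ### The event "`z` is to the right of `K`" is measurable -/

namespace RightConfig

/-- **For `K ∈ Ω₊` and `z ∈ ℍ ∖ K` there is a `+`-hull through `z` avoided by `K`, the fill of
a finite union of dyadic squares**: join `z` to a point just above `1` inside the open connected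
`ℍ ∖ K`, drop a stick to `1`, and thicken by the dyadic squares of a fine generation; the
resulting compact set is attached to the lower half-plane at `1`, misses `K ⊇ (−∞, 0]`, so its
fill is a `+`-hull (`isPlusHull_hpFill`) avoided by `K` (`disjoint_hpFill`). [folklore] -/
theorem exists_dyadicUnion_isPlusHull_hpFill (K : RightConfig) {z : ℂ} (hz : z ∈ upperHalfPlaneSet)
    (hzK : z ∉ (K : Set ℂ)) :
    ∃ (n : ℕ) (F : Finset (ℤ × ℤ)), z ∈ dyadicUnion n F ∧
      IsPlusHull (hpFill (dyadicUnion n F)) ∧ Disjoint (K : Set ℂ) (hpFill (dyadicUnion n F)) := by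
  set D : Set ℂ := upperHalfPlaneSet \ (K : Set ℂ) with hD
  have hDo : IsOpen D := isOpen_upperHalfPlaneSet.sdiff K.isClosed
  have hDc : IsConnected D := K.isConnected_diff
  -- a point just above `1`, away from `K`
  have h1K : (1 : ℂ) ∉ (K : Set ℂ) := fun h ↦ by
    have := (K.ofReal_mem_iff (x := 1)).1 (by exact_mod_cast h)
    linarith
  obtain ⟨r₀, hr₀, hr₀K⟩ := Metric.isOpen_iff.1 K.isClosed.isOpen_compl 1 h1K
  set r : ℝ := r₀ / 2 with hr
  have hrpos : 0 < r := by positivity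
  set w₀ : ℂ := 1 + (r : ℂ) * Complex.I with hw₀
  have hstick : ∀ t ∈ Icc (0 : ℝ) r, (1 : ℂ) + (t : ℂ) * Complex.I ∉ (K : Set ℂ) := fun t ht h ↦ by
    refine hr₀K ?_ h
    rw [mem_ball, dist_eq_norm, add_sub_cancel_left, norm_mul, Complex.norm_real, Complex.norm_I,
      mul_one, Real.norm_eq_abs, abs_of_nonneg ht.1]
    linarith [ht.2]
  have hw₀D : w₀ ∈ D := by
    refine ⟨?_, hstick r ⟨hrpos.le, le_rfl⟩⟩
    show 0 < (1 + (r : ℂ) * Complex.I).im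
    simpa using hrpos
  -- a path from `z` to `w₀` in `D`, plus the stick down to `1`
  have hJ : JoinedIn D z w₀ := (hDo.isConnected_iff_isPathConnected.1 hDc).joinedIn z ⟨hz, hzK⟩ _ hw₀D
  set π : Path z w₀ := hJ.somePath with hπ
  have hπD : ∀ t, π t ∈ D := hJ.somePath_mem
  set T : Set ℂ := (fun t : ℝ ↦ (1 : ℂ) + (t : ℂ) * Complex.I) '' Icc 0 r with hT
  set C : Set ℂ := range π ∪ T with hC
  have hTc : IsCompact T := isCompact_Icc.image (by fun_prop)
  have hCc : IsCompact C := (isCompact_range π.continuous).union hTc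
  have hCK : C ⊆ (K : Set ℂ)ᶜ := by
    rintro w (⟨t, rfl⟩ | ⟨t, ht, rfl⟩)
    · exact (hπD t).2
    · exact hstick t ht
  have hw₀T : w₀ ∈ T := ⟨r, ⟨hrpos.le, le_rfl⟩, rfl⟩
  have h1T : (1 : ℂ) ∈ T := ⟨0, ⟨le_rfl, hrpos.le⟩, by simp⟩
  have hCconn : IsConnected C := by
    refine IsConnected.union ⟨w₀, ⟨1, π.target⟩, hw₀T⟩ (isConnected_range π.continuous) ?_
    exact (isConnected_Icc hrpos.le).image _ (by fun_prop : Continuous fun t : ℝ ↦ (1 : ℂ) + (t : ℂ) * Complex.I).continuousOn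
  -- a fine generation `n`: squares meeting `C` stay off `K`
  obtain ⟨δ, hδ, hδK⟩ := hCc.exists_cthickening_subset_open K.isClosed.isOpen_compl hCK
  obtain ⟨n, hn⟩ : ∃ n : ℕ, (2 : ℝ) / 2 ^ n ≤ δ := by
    obtain ⟨n, hn⟩ := exists_nat_gt (2 / δ)
    refine ⟨n, ?_⟩
    have h2n : (n : ℝ) < 2 ^ n := by exact_mod_cast Nat.lt_two_pow_self
    have h2 : (0 : ℝ) < 2 ^ n := by positivity
    rw [div_le_iff₀ h2]
    rw [div_lt_iff₀ hδ] at hn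
    nlinarith
  set F : Finset (ℤ × ℤ) := (finite_setOf_dyadicSquare_inter_nonempty hCc.isBounded n).toFinset with hF
  have hmemF : ∀ p : ℤ × ℤ, p ∈ F ↔ (dyadicSquare n p.1 p.2 ∩ C).Nonempty := fun p ↦ by
    rw [hF, Set.Finite.mem_toFinset]
    rfl
  set S : Set ℂ := dyadicUnion n F with hS
  have hCS : C ⊆ S := fun w hw ↦ by
    rw [hS, mem_dyadicUnion_iff]
    exact ⟨⟨_, _⟩, (hmemF _).2 ⟨w, mem_dyadicSquare_floor w n, hw⟩, mem_dyadicSquare_floor w n⟩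
  have hSK : S ⊆ (K : Set ℂ)ᶜ := fun w hw ↦ by
    rw [hS, mem_dyadicUnion_iff] at hw
    obtain ⟨p, hp, hwp⟩ := hw
    obtain ⟨c, hcp, hcC⟩ := (hmemF p).1 hp
    exact hδK (mem_cthickening_of_dist_le w c δ C hcC ((dist_le_of_mem_dyadicSquare hwp hcp).trans hn))
  have hKS : Disjoint (K : Set ℂ) S := Set.disjoint_left.2 fun w hwK hwS ↦ hSK hwS hwK
  have hSclosed : IsClosed S := isClosed_dyadicUnion
  have hSb : IsBounded S := isBounded_dyadicUnion
  have hSaxis : Disjoint S nonposAxis :=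
    Set.disjoint_left.2 fun w hwS hw ↦ hSK hwS (K.nonposAxis_subset hw)
  -- `S ∪ {Im ≤ 0}` is connected: every square meets the connected set `C ∪ {Im ≤ 0} ∋ 1`
  have hconn : IsConnected (S ∪ {w : ℂ | w.im ≤ 0}) := by
    have h1C : (1 : ℂ) ∈ C := Or.inr h1T
    have h1L : (1 : ℂ) ∈ {w : ℂ | w.im ≤ 0} := by simp
    have hD' : IsPreconnected (C ∪ {w : ℂ | w.im ≤ 0}) :=
      (IsConnected.union ⟨1, h1C, h1L⟩ hCconn
        ((convex_halfSpace_im_le 0).isConnected ⟨0, by simp⟩)).isPreconnected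
    have hDsub : C ∪ {w : ℂ | w.im ≤ 0} ⊆ S ∪ {w : ℂ | w.im ≤ 0} := union_subset_union_left _ hCS
    refine ⟨⟨1, Or.inl (hCS (Or.inr h1T))⟩, isPreconnected_of_forall 1 ?_⟩
    rintro y (hy | hy)
    · rw [hS, mem_dyadicUnion_iff] at hy
      obtain ⟨p, hp, hyp⟩ := hy
      obtain ⟨c, hcp, hcC⟩ := (hmemF p).1 hp
      refine ⟨dyadicSquare n p.1 p.2 ∪ (C ∪ {w : ℂ | w.im ≤ 0}), ?_, Or.inr (Or.inl (Or.inr h1T)),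
        Or.inl hyp, ?_⟩
      · refine union_subset (fun w hw ↦ Or.inl ?_) hDsub
        rw [hS, mem_dyadicUnion_iff]
        exact ⟨p, hp, hw⟩
      · exact IsPreconnected.union c hcp (Or.inl hcC) convex_dyadicSquare.isPreconnected hD'
    · exact ⟨C ∪ {w : ℂ | w.im ≤ 0}, hDsub, Or.inl (Or.inr h1T), Or.inr hy, hD'⟩
  refine ⟨n, F, hCS (Or.inl ⟨0, π.source⟩), isPlusHull_hpFill hSclosed hSb hSaxis hconn,
    K.disjoint_hpFill hSclosed hSb hSaxis hKS⟩

/-- The **detection events** on `Ω₊`: `K` avoids a `+`-hull which is the fill of a finite union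
of dyadic squares containing `z` (a countable union of generating events). [folklore] -/
def missPt (z : ℂ) : Set RightConfig :=
  ⋃ (n : ℕ) (F : Finset (ℤ × ℤ)) (_ : z ∈ dyadicUnion n F ∧ IsPlusHull (hpFill (dyadicUnion n F))),
    avoid (hpFill (dyadicUnion n F))

/-- The detection events are measurable. [folklore] -/
theorem measurableSet_missPt (z : ℂ) : MeasurableSet (missPt z) :=
  MeasurableSet.iUnion fun _ ↦ MeasurableSet.iUnion fun _ ↦ MeasurableSet.iUnion fun h ↦
    measurableSet_avoid h.2

/-- **"`z` is to the right of `K`" is the detection event**: `{K ∈ Ω₊ : z ∉ K} = missPt z` for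
`z ∈ ℍ`. [folklore] -/
theorem setOf_notMem_eq_missPt {z : ℂ} (hz : z ∈ upperHalfPlaneSet) :
    {K : RightConfig | z ∉ (K : Set ℂ)} = missPt z := by
  ext K
  simp only [mem_setOf_eq, missPt, mem_iUnion, mem_avoid, exists_prop]
  constructor
  · intro hzK
    obtain ⟨n, F, hzS, hplus, hdisj⟩ := K.exists_dyadicUnion_isPlusHull_hpFill hz hzK
    exact ⟨n, F, ⟨hzS, hplus⟩, hdisj⟩
  · rintro ⟨n, F, ⟨hzS, -⟩, hdisj⟩ hzK
    exact Set.disjoint_left.1 hdisj hzK (inter_subset_hpFill _ ⟨hzS, hz⟩)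

/-- **The event "`z` is to the right of `K`", `{K ∈ Ω₊ : z ∉ K}`, is measurable** for `z ∈ ℍ`
(in the proof of [LSW] Cor. 8.6, p. 38: "the probability that `i` ends up eventually to the
right of the right hand boundary"). [cite: LawlerSchrammWerner2003Restriction, proof of Cor. 8.6 (p. 38) with §8.1 p. 31] -/
theorem measurableSet_notMem {z : ℂ} (hz : z ∈ upperHalfPlaneSet) :
    MeasurableSet {K : RightConfig | z ∉ (K : Set ℂ)} := by
  rw [setOf_notMem_eq_missPt hz]
  exact measurableSet_missPt z

end RightConfig

/-! ### The deep input of Cor. 8.6: Thm. 8.4 for `ρ < 0` -/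

/-- NAMED FACT — **`P⁺_α` exists for `0 < α < 5/8` and puts `i` to the right of `K` with
probability `> 1/2`** — the SLE(8/3, ρ) input of the proof of [LSW] Cor. 8.6. Printed
ingredients: **Thm. 8.4** (p. 37): "Let `ρ > −2`, and let `K = F^{ℝ₊}_ℍ(cl K_∞)`, where `K_t`
is the hull of SLE(8/3, ρ) and `K_∞ = ⋃_{t ≥ 0} K_t`. Then `K` satisfies the right-sided
restriction property with exponent `α = (20 + 16ρ + 3ρ²)/32 = (3ρ + 10)(2 + ρ)/32`." and "when
`ρ` spans `(−2, ∞)`, `α` spans `(0, ∞)`" (so `0 < α < 5/8` iff `−2 < ρ < 0`; the law of `K` is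
then `P⁺_α` by §8.1 p. 31, the right-sided restriction property giving
`P[K ∩ A = ∅] = Φ'_A(0)^α` for `A ∈ 𝒬₊`; `K ∈ Ω₊` by Lemma 8.3 (p. 36): for `κ ≤ 4`,
`K_∞ ∩ ℝ = {0}` or `(−∞, 0]`, `K_∞` unbounded); and the first half of the proof of Cor. 8.6
(p. 38): "Note that when `ρ < 0`, `W_t − √κ B_t` is decreasing. It follows easily that the
probability that `i` ends up eventually to 'the right' of the right hand boundary of
SLE(8/3, ρ) … is strictly larger than the corresponding quantity for SLE(8/3, 0), which is
`1/2` by symmetry." — here "`i` to the right" means that `i` lies in the component of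
`ℍ̄ ∖ cl K_∞` bordering `[0, ∞)`, i.e. `i ∉ K = F^{ℝ₊}_ℍ(cl K_∞)`, the event whose
`P_α`-probability the second half of the proof bounds by `1/2` ("the probability that it passes
to the left of `i`"); the parenthesis "(i.e., `i` is separated from `1` by `K_∞ ∪ (−∞, 0]`)" on
p. 38 names the other side (as `ρ ↓ −2`, `α ↓ 0` and `K` shrinks to `(−∞, 0]`, §8.1, so the
probability in question tends to `1`, not `0`). Not in the tree: SLE(κ, ρ) (Bessel-type driving processes, §8.3),
Thm. 8.4 (§8.4, Itô's formula for `h_t'(W_t)^{5/8} h_t'(O_t)^b (…)^c`), the monotone coupling.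
[cite: LawlerSchrammWerner2003Restriction, Thm. 8.4 (p. 37) with Lemma 8.3 (p. 36), §8.1 (p. 31) and proof of Cor. 8.6 (p. 38)] -/
def exists_isRightRestrictionMeasure_lt_five_eighths : Prop :=
  ∀ α : ℝ, 0 < α → α < 5 / 8 →
    ∃ Q : Measure RightConfig, IsRightRestrictionMeasure α Q ∧ 1 / 2 < Q {K | Complex.I ∉ (K : Set ℂ)}

end Literature.Probability.RandomPlanarGeometry

end
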